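import Literature.NumberTheory.EllipticCurves.DegreeConjectureAbcMurtyProofs
import Literature.NumberTheory.EllipticCurves.SzpiroLocalDataProofs
import Literature.NumberTheory.DiophantineGeometry.MinimalDiscriminantFactorizationProofs
import Literature.Barriers.ABC.BakerMethodBounds
import HarnessLib

/-!
# Route DefiniteXi — item `PolyFreyDegree` (stmt-ABC-2026): the valuation input `v_q(Δ_min) ≤ K N^B`

Companion (part C) of `Summits/ABC/ABC/Theorems/DefiniteXiPolyFreyDegree.lean`, kept separate for the
400-line limit.  The route docstring of `PolyFreyDegree` asserts
"XiBound ∧ DefiniteRTControl (poly form) ∧ v_q(Δ) ≤ N^16 (StewartTijdeman1986) ⟹ PolyFreyDegree";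
this file supplies the third conjunct from the named fact
`Literature.Barriers.ABC.stewartTijdeman1986_upperBound` (Stewart–Tijdeman 1986: `log c ≤ κ rad(abc)^{15}`
for abc triples; implied by Stewart–Yu 2001 = `Literature.NumberTheory.DiophantineGeometry.stewart_yu`
via `stewartTijdeman1986_of_stewartYu`; not discharged in the tree — lower bounds for linear forms in
logarithms are not in Mathlib):

* `factorization_minimalDiscriminantNorm_freyCurve_le` — at an odd prime `q`,
  `v_q(Δ_min(E_{a,b})) ≤ 2 v_q(ab(a+b))` (the integral model (12.17) of Bombieri–Gubler Ex. 12.5.10 is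
  minimal at odd primes; unconditional);
* `log_natAbs_le_of_stewartTijdeman` — `log|ab(a+b)| ≤ 3κ rad|ab(a+b)|^{15}` for coprime `a, b` with
  `ab(a+b) ≠ 0` (signs rearranged into an abc triple, as in `abc_int_of_abcLe`);
* `freyValuationBound_of_stewartTijdeman` — for coprime `a, b`, conductor `N`, odd prime `q`:
  `v_q(Δ_min(E_{a,b})) ≤ 4 · 2^{15} κ · N^{15}` (`2^v ≤ |ab(a+b)|`, `rad|ab(a+b)| ≤ 2N`).

## References

* C. L. Stewart, R. Tijdeman, *On the Oesterlé–Masser conjecture*, Monatsh. Math. 102 (1986).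
* C. L. Stewart, K. Yu, *On the abc conjecture II*, Duke Math. J. 108 (2001), Thm 1.
* E. Bombieri, W. Gubler, *Heights in Diophantine Geometry* (2006), Ex. 12.5.10.
-/

-- Summit.<Summit>.<Problem> is the mandated namespace; for the single-conjunct summit ABC the duplicate ABC.ABC is deliberate.
set_option linter.dupNamespace false

noncomputable section

namespace Summit.ABC.ABC.Theorems.DefiniteXiPolyFreyDegree

open Literature.NumberTheory
open Literature.NumberTheory.EllipticCurves
open Literature.NumberTheory.DiophantineGeometry
open UniqueFactorizationMonoid

/-! ## (C) The valuation input `v_q(Δ_min) ≤ K N^B` from Stewart–Tijdeman -/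

/-- At an odd prime `q`, `v_q(Δ_min(E_{a,b})) ≤ 2 v_q(ab(a+b))` for coprime `a, b` with
`ab(a+b) ≠ 0`: the integral model (12.17) is minimal at `q`
(`isMinimalAt_freyIntModel_of_natGenerator_ne_two`), so `q^{ord_q Δ_min} ∣ Δ = 16 (ab(a+b))²`
(`pow_ordMinimalDiscriminant_dvd_Δ`), and `ord_q Δ_min = v_q |Δ_min|`
(`factorization_minimalDiscriminantNorm_holds`). (In fact equality holds.) [folklore] -/
theorem factorization_minimalDiscriminantNorm_freyCurve_le {a b : ℤ} (hab : IsCoprime a b)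
    (h0 : a * b * (a + b) ≠ 0) {q : ℕ} (hq : q.Prime) (hq2 : q ≠ 2) :
    ((freyCurve a b).minimalDiscriminantNorm ℤ).factorization q ≤
      2 * (a * b * (a + b)).natAbs.factorization q := by
  obtain ⟨v, hv⟩ := exists_place ⟨q, hq⟩
  have hvq : Rat.HeightOneSpectrum.natGenerator v = q := hv
  rw [← baseChange_freyIntModel]
  haveI := isElliptic_freyIntModel h0
  have hmin := isMinimalAt_freyIntModel_of_natGenerator_ne_two hab v (by rw [hvq]; exact hq2)
  have hfac := WeierstrassCurve.factorization_minimalDiscriminantNorm_holds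
    ((freyIntModel a b).baseChange ℚ) v
  have hdvd := WeierstrassCurve.pow_ordMinimalDiscriminant_dvd_Δ hmin
  rw [freyIntModel_Δ, hvq] at hdvd
  rw [hvq] at hfac
  set k := ((freyIntModel a b).baseChange ℚ).ordMinimalDiscriminant v with hk
  have hm0 : (a * b * (a + b)).natAbs ≠ 0 := Int.natAbs_ne_zero.mpr h0
  have hdvd' : q ^ k ∣ 16 * (a * b * (a + b)).natAbs ^ 2 := by
    have h := Int.natAbs_dvd_natAbs.mpr hdvd
    rwa [Int.natAbs_pow, Int.natAbs_natCast, Int.natAbs_mul, Int.natAbs_pow] at h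
  have h16 : (16 : ℕ) * (a * b * (a + b)).natAbs ^ 2 ≠ 0 := by positivity
  have hle := (hq.pow_dvd_iff_le_factorization h16).mp hdvd'
  rw [Nat.factorization_mul (by norm_num) (pow_ne_zero 2 hm0), Nat.factorization_pow,
    Finsupp.add_apply, Finsupp.smul_apply, smul_eq_mul, show (16 : ℕ) = 2 ^ 4 by norm_num,
    Nat.factorization_pow, Finsupp.smul_apply, smul_eq_mul, Nat.prime_two.factorization,
    Finsupp.single_apply, if_neg (Ne.symm hq2), mul_zero, zero_add] at hle
  rw [hfac]
  exact hle

/-- **Stewart–Tijdeman for signed pairs.** From `stewartTijdeman1986_upperBound`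
(`log c ≤ κ · rad(abc)^{15}` for abc triples) : for coprime integers `a, b` with `ab(a+b) ≠ 0`,
`log |ab(a+b)| ≤ 3κ · rad|ab(a+b)|^{15}` — rearrange signs so that the two of `|a|, |b|, |a+b|` adding
up to the third are the `a, b` of an abc triple (as in `abc_int_of_abcLe`), and `|ab(a+b)| ≤ c³`.
[folklore] -/
theorem log_natAbs_le_of_stewartTijdeman
    (hST : Literature.Barriers.ABC.stewartTijdeman1986_upperBound) :
    ∃ κ : ℝ, 0 ≤ κ ∧ ∀ a b : ℤ, IsCoprime a b → a * b * (a + b) ≠ 0 →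
      Real.log ((a * b * (a + b)).natAbs : ℝ) ≤
        κ * ((radical (a * b * (a + b)).natAbs : ℕ) : ℝ) ^ (15 : ℝ) := by
  obtain ⟨κ₀, hκ₀⟩ := hST
  refine ⟨3 * max κ₀ 0, by positivity, fun a b hab h0 ↦ ?_⟩
  -- the bound for an abc triple `(m, n, m + n)` bounds `log (m n (m+n))`
  have key : ∀ m n k : ℕ, 0 < m → 0 < n → m + n = k → Nat.Coprime m n →
      Real.log ((m * n * k : ℕ) : ℝ) ≤
        3 * max κ₀ 0 * ((radical (m * n * k) : ℕ) : ℝ) ^ (15 : ℝ) := by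
    intro m n k hm hn hk hmn
    have h := hκ₀ m n k ⟨hm, hn, hk, hmn⟩
    rw [pow_zero, mul_one, rad_def] at h
    have hR : (0 : ℝ) ≤ ((radical (m * n * k) : ℕ) : ℝ) ^ (15 : ℝ) := by positivity
    have hk0 : 0 < k := by omega
    have hlogk : Real.log k ≤ max κ₀ 0 * ((radical (m * n * k) : ℕ) : ℝ) ^ (15 : ℝ) :=
      h.trans (mul_le_mul_of_nonneg_right (le_max_left _ _) hR)
    have hle : m * n * k ≤ k ^ 3 := by
      have hmk : m ≤ k := by omega
      have hnk : n ≤ k := by omega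
      calc m * n * k ≤ k * k * k := by gcongr
        _ = k ^ 3 := by ring
    have hleR : ((m * n * k : ℕ) : ℝ) ≤ (k : ℝ) ^ 3 := by exact_mod_cast hle
    have hpos : (0 : ℝ) < ((m * n * k : ℕ) : ℝ) := by positivity
    calc Real.log ((m * n * k : ℕ) : ℝ) ≤ Real.log ((k : ℝ) ^ 3) := Real.log_le_log hpos hleR
      _ = 3 * Real.log k := by rw [Real.log_pow]; norm_num
      _ ≤ 3 * (max κ₀ 0 * ((radical (m * n * k) : ℕ) : ℝ) ^ (15 : ℝ)) :=
          mul_le_mul_of_nonneg_left hlogk (by norm_num)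
      _ = 3 * max κ₀ 0 * ((radical (m * n * k) : ℕ) : ℝ) ^ (15 : ℝ) := by ring
  -- the three arrangements of signs
  have hA : a ≠ 0 := fun h ↦ h0 (by rw [h]; ring)
  have hB : b ≠ 0 := fun h ↦ h0 (by rw [h]; ring)
  have hD : a + b ≠ 0 := fun h ↦ h0 (by rw [h]; ring)
  set x := a.natAbs with hx
  set y := b.natAbs with hy
  set z := (a + b).natAbs with hz
  have hx0 : 0 < x := Int.natAbs_pos.mpr hA
  have hy0 : 0 < y := Int.natAbs_pos.mpr hB
  have hz0 : 0 < z := Int.natAbs_pos.mpr hD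
  have hprod : (a * b * (a + b)).natAbs = x * y * z := by simp [hx, hy, hz, Int.natAbs_mul]
  rw [hprod]
  have cop : ∀ {M N : ℤ}, IsCoprime M N → Nat.Coprime M.natAbs N.natAbs := by
    intro M N h
    rw [Nat.Coprime, ← Int.gcd_eq_natAbs]
    exact Int.isCoprime_iff_gcd_eq_one.mp h
  have hAD : IsCoprime a (a + b) := by
    obtain ⟨u, w, huw⟩ := hab
    exact ⟨u - w, w, by linear_combination huw⟩
  have hBD : IsCoprime b (a + b) := by
    obtain ⟨u, w, huw⟩ := hab
    exact ⟨w - u, u, by linear_combination huw⟩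
  have hcases : x + y = z ∨ x + z = y ∨ y + z = x := by omega
  rcases hcases with h | h | h
  · exact key x y z hx0 hy0 h (cop hab)
  · have h1 := key x z y hx0 hz0 h (cop hAD)
    rwa [show x * z * y = x * y * z by ring] at h1
  · have h1 := key y z x hy0 hz0 h (cop hBD)
    rwa [show y * z * x = x * y * z by ring] at h1

/-- **The valuation input of the weak rung, from Stewart–Tijdeman.** Given
`stewartTijdeman1986_upperBound` (Stewart–Tijdeman 1986, `log c ≤ κ rad(abc)^{15}`; implied by
Stewart–Yu 2001, tree `stewartTijdeman1986_of_stewartYu`), for coprime `a, b` with `ab(a+b) ≠ 0`,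
conductor `N`, and every odd prime `q`: `v_q(Δ_min(E_{a,b})) ≤ K · N^{15}` with an absolute `K`.
Chain: `v_q(Δ_min) ≤ 2 v_q(ab(a+b))`, `2^{v} ≤ q^{v} ≤ |ab(a+b)|`, `log|ab(a+b)| ≤ 3κ R^{15}`,
`R = rad|ab(a+b)| ≤ 2N` (`radical_natAbs_dvd_two_mul_conductorNorm_freyCurve`). [folklore] -/
theorem freyValuationBound_of_stewartTijdeman
    (hST : Literature.Barriers.ABC.stewartTijdeman1986_upperBound) :
    ∃ B K : ℝ, ∀ a b : ℤ, IsCoprime a b → a * b * (a + b) ≠ 0 → ∀ (N : ℕ) [NeZero N],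
      (freyCurve a b).conductorNorm ℤ = N → ∀ q : ℕ, q.Prime → q ≠ 2 → q ∣ N →
        ((((freyCurve a b).minimalDiscriminantNorm ℤ).factorization q : ℕ) : ℝ) ≤
          K * (N : ℝ) ^ B := by
  obtain ⟨κ, hκ0, hκ⟩ := log_natAbs_le_of_stewartTijdeman hST
  refine ⟨15, 4 * 2 ^ (15 : ℕ) * κ, fun a b hab h0 N _ hN q hq hq2 _ ↦ ?_⟩
  set m : ℤ := a * b * (a + b) with hm
  set v : ℕ := m.natAbs.factorization q with hvdef
  have hm0 : m.natAbs ≠ 0 := Int.natAbs_ne_zero.mpr h0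
  -- (1) `v_q(Δ_min) ≤ 2 v`
  have h1 : ((freyCurve a b).minimalDiscriminantNorm ℤ).factorization q ≤ 2 * v :=
    factorization_minimalDiscriminantNorm_freyCurve_le hab h0 hq hq2
  have h1R : ((((freyCurve a b).minimalDiscriminantNorm ℤ).factorization q : ℕ) : ℝ) ≤ 2 * (v : ℝ) := by
    exact_mod_cast h1
  -- (2) `v · log 2 ≤ log |m|`
  have hqv : q ^ v ≤ m.natAbs := Nat.ordProj_le q hm0
  have h2v : 2 ^ v ≤ m.natAbs := (Nat.pow_le_pow_left hq.two_le v).trans hqv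
  have hmpos : (0 : ℝ) < (m.natAbs : ℝ) := by exact_mod_cast Nat.pos_of_ne_zero hm0
  have hvlog : (v : ℝ) * Real.log 2 ≤ Real.log (m.natAbs : ℝ) := by
    have h : ((2 : ℝ) ^ v) ≤ (m.natAbs : ℝ) := by exact_mod_cast h2v
    have := Real.log_le_log (by positivity) h
    rwa [Real.log_pow] at this
  -- (3) `log |m| ≤ κ R^15`, `R ≤ 2N`
  have h3 := hκ a b hab h0
  have hrad := radical_natAbs_dvd_two_mul_conductorNorm_freyCurve hab h0
  rw [hN] at hrad
  have hR : ((radical m.natAbs : ℕ) : ℝ) ≤ 2 * (N : ℝ) := by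
    have := Nat.le_of_dvd (Nat.pos_of_ne_zero (mul_ne_zero two_ne_zero (NeZero.ne N))) hrad
    exact_mod_cast this
  have hR0 : (0 : ℝ) ≤ ((radical m.natAbs : ℕ) : ℝ) := Nat.cast_nonneg _
  have hN0 : (0 : ℝ) ≤ (N : ℝ) := Nat.cast_nonneg N
  have hR15 : ((radical m.natAbs : ℕ) : ℝ) ^ (15 : ℝ) ≤ 2 ^ (15 : ℕ) * (N : ℝ) ^ (15 : ℝ) := by
    rw [show (15 : ℝ) = ((15 : ℕ) : ℝ) by norm_num, Real.rpow_natCast, Real.rpow_natCast,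
      ← mul_pow]
    exact pow_le_pow_left₀ hR0 hR 15
  have hlog2 : (1 / 2 : ℝ) ≤ Real.log 2 := by
    have := Real.log_two_gt_d9
    linarith
  have hv0 : (0 : ℝ) ≤ (v : ℝ) := Nat.cast_nonneg _
  -- assemble: `v ≤ 2 log|m| ≤ 2 κ R^15 ≤ 2 κ 2^15 N^15`
  have hv : (v : ℝ) ≤ 2 * (κ * (2 ^ (15 : ℕ) * (N : ℝ) ^ (15 : ℝ))) := by
    have hv2 : (v : ℝ) ≤ 2 * Real.log (m.natAbs : ℝ) := by nlinarith
    calc (v : ℝ) ≤ 2 * Real.log (m.natAbs : ℝ) := hv2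
      _ ≤ 2 * (κ * ((radical m.natAbs : ℕ) : ℝ) ^ (15 : ℝ)) := by linarith
      _ ≤ 2 * (κ * (2 ^ (15 : ℕ) * (N : ℝ) ^ (15 : ℝ))) := by
          gcongr
  calc ((((freyCurve a b).minimalDiscriminantNorm ℤ).factorization q : ℕ) : ℝ) ≤ 2 * (v : ℝ) := h1R
    _ ≤ 2 * (2 * (κ * (2 ^ (15 : ℕ) * (N : ℝ) ^ (15 : ℝ)))) := by linarith
    _ = 4 * 2 ^ (15 : ℕ) * κ * (N : ℝ) ^ (15 : ℝ) := by ring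

end Summit.ABC.ABC.Theorems.DefiniteXiPolyFreyDegree

end
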